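import Summits.Ventures.HodgeRepro.Night4ReducedDimEight

/-!
# The reduced dimension `dim B_red` of every census face of degree 8 — on the kernel, II: `C4 × C2`, `C2 × C2 × C2`

Blind re-derivation cell `pub-hodge-repro`, seat `night-4` (ROUTE HARDENING for the Monday FINAL, gen 4).  Target tree
path `lean/Summits/Ventures/HodgeRepro/Night4ReducedDimEightAbelian.lean`.

`route/ROUTE.md` (v2.89) §3.3, the abelian non-cyclic groups of order 8 (the lead's enumeration + p1's engine): «C4 × C2:
(c = 1 or 5) 4 classes — 1+2+4 (dim 7) ×2, 1+1+4 (dim 6), 2+4 (dim 6); (c = 4) 2+4 ×2, 2+2+4 (dim 8) ×2. C2³ (any of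
its 7 involutions): 6 classes, all 1+1+4 (A × E × E′, E, E′ CM by two DIFFERENT imaginary quadratic subfields)»; §3.5 (i):
«the sixfolds A × E × E′ (C2³, C4 × C2) and A × S (C4 × C2)».  In the typer's `Groups.lean` the three central involutions
of `C4 × C2` are `cc_C4xC2_sq = (2, 0)` (the route's «c = 4», a square), `cc_C4xC2_ns = (0, 1)` and `cc_C4xC2_ns' = (2, 1)`
(the route's «c = 1 or 5», not squares); the named involution of `C2 × C2 × C2` is `cc_C2xC2xC2 = (1, 0, 0)` — p6's
`classify8` (not landed) sends every central involution of an elementary abelian group of order 8 to this one, and the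
other six are its images under `Aut(C2³) = GL₃(𝔽₂)`, which is transitive on the involutions; they are NOT computed here.

With the reduction to place representatives of part I (`redDim_faceCorners_of_reps`), each count is ONE
`decide +kernel` over the 16 CM types and the 12 ordered pairs of representatives in distinct places:

* `redDim_faceCorners_C4xC2_sq = 6 ∨ = 8` (A × S or A × S × S′: corners a simple fourfold and CM surfaces);
* `redDim_faceCorners_C4xC2_ns = 6 ∨ = 7` and `redDim_faceCorners_C4xC2_ns' = 6 ∨ = 7` (A × E × E′, A × S or A × S × E);
* `redDim_faceCorners_C2xC2xC2 = 6` (always A × E × E′);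
* every value is attained (explicit witness faces); the corner dimensions `simpleDim ∈ {2, 4}` / `{1, 2, 4}` / `{1, 4}`;
* the same on the roster's face of the product datum.

Together with part I: over the seven named `(G, c)` of order 8, `dim B_red` takes exactly the values `6`, `7`, `8` —
ROUTE.md §3.3's «dim B_red 6–8» with the per-group table, on the kernel; `7` occurs only on `C4 × C2` with a non-square
involution.  Nothing here says anything about the status of the Hodge conjecture for CM abelian varieties, which is NOT
proved.
-/

set_option autoImplicit false

open Finset

namespace HodgeRepro

/-! ## `C4 × C2`, `c = (2, 0)` (a square) — `dim B_red ∈ {6, 8}` -/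

/-- Representatives of the four places of `(C4 × C2, cc_C4xC2_sq)`. -/
def night4Reps_C4xC2_sq : List C4xC2 :=
  [Multiplicative.ofAdd (0, 0), Multiplicative.ofAdd (0, 1), Multiplicative.ofAdd (1, 0), Multiplicative.ofAdd (1, 1)]

/-- `night4Reps_C4xC2_sq` meets every place. -/
theorem night4Reps_C4xC2_sq_cover : ∀ p : C4xC2, ∃ r ∈ night4Reps_C4xC2_sq, r = p ∨ cc_C4xC2_sq * r = p := by decide

/-- The count on the representatives (KERNEL). -/
theorem redDim_faceCorners_C4xC2_sq_reps : ∀ Φ ∈ cmTypes cc_C4xC2_sq,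
    ∀ p ∈ night4Reps_C4xC2_sq, ∀ p' ∈ night4Reps_C4xC2_sq, p' ∉ place cc_C4xC2_sq p →
      redDim (faceCorners cc_C4xC2_sq Φ p p') = 6 ∨ redDim (faceCorners cc_C4xC2_sq Φ p p') = 8 := by
  decide +kernel

/-- **Every census face of `(C4 × C2, c = (2, 0))` has `dim B_red = 6` or `8`** (ROUTE.md §3.3: «(c = 4) 2+4 ×2, 2+2+4
(dim 8) ×2»).  KERNEL. -/
theorem redDim_faceCorners_C4xC2_sq (Φ : Finset C4xC2) (p p' : C4xC2) (hΦ : IsCMType cc_C4xC2_sq Φ)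
    (hp : p' ∉ place cc_C4xC2_sq p) :
    redDim (faceCorners cc_C4xC2_sq Φ p p') = 6 ∨ redDim (faceCorners cc_C4xC2_sq Φ p p') = 8 :=
  redDim_faceCorners_of_reps cc_C4xC2_sq_isComplexConj night4Reps_C4xC2_sq night4Reps_C4xC2_sq_cover (fun n => n = 6 ∨ n = 8) Φ
    (redDim_faceCorners_C4xC2_sq_reps Φ (mem_cmTypes.2 hΦ)) p p' hp

/-- The value 6 is attained on `(C4 × C2, c = (2, 0))` (A × S). -/
theorem redDim_faceCorners_C4xC2_sq_six : ∃ (Φ : Finset C4xC2) (p p' : C4xC2), IsCMType cc_C4xC2_sq Φ ∧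
    p' ∉ place cc_C4xC2_sq p ∧ redDim (faceCorners cc_C4xC2_sq Φ p p') = 6 :=
  ⟨{Multiplicative.ofAdd (2, 0), Multiplicative.ofAdd (2, 1), Multiplicative.ofAdd (3, 0), Multiplicative.ofAdd (3, 1)},
    Multiplicative.ofAdd (0, 0), Multiplicative.ofAdd (0, 1), by decide, by decide, by decide +kernel⟩

/-- The value 8 is attained on `(C4 × C2, c = (2, 0))` (A × S × S′). -/
theorem redDim_faceCorners_C4xC2_sq_eight : ∃ (Φ : Finset C4xC2) (p p' : C4xC2), IsCMType cc_C4xC2_sq Φ ∧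
    p' ∉ place cc_C4xC2_sq p ∧ redDim (faceCorners cc_C4xC2_sq Φ p p') = 8 :=
  ⟨{Multiplicative.ofAdd (2, 0), Multiplicative.ofAdd (2, 1), Multiplicative.ofAdd (3, 0), Multiplicative.ofAdd (3, 1)},
    Multiplicative.ofAdd (0, 0), Multiplicative.ofAdd (1, 0), by decide, by decide, by decide +kernel⟩

/-- The corners of `(C4 × C2, c = (2, 0))`: every CM type is primitive (`simpleDim = 4`) or a lift from a quartic CM
subfield (`simpleDim = 2`); no lift from an imaginary quadratic subfield, since the square `c = (2, 0)` lies in every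
subgroup of order 4 (`⟨(1, 0)⟩`, `⟨(1, 1)⟩` and `⟨(2, 0), (0, 1)⟩`) and a stabiliser never contains `c`.  KERNEL. -/
theorem simpleDim_C4xC2_sq : ∀ Φ : Finset C4xC2, IsCMType cc_C4xC2_sq Φ → simpleDim Φ = 2 ∨ simpleDim Φ = 4 := by
  decide +kernel

/-! ## `C4 × C2`, `c = (0, 1)` (not a square) — `dim B_red ∈ {6, 7}` -/

/-- Representatives of the four places of `(C4 × C2, cc_C4xC2_ns)`. -/
def night4Reps_C4xC2_ns : List C4xC2 :=
  [Multiplicative.ofAdd (0, 0), Multiplicative.ofAdd (1, 0), Multiplicative.ofAdd (2, 0), Multiplicative.ofAdd (3, 0)]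

/-- `night4Reps_C4xC2_ns` meets every place. -/
theorem night4Reps_C4xC2_ns_cover : ∀ p : C4xC2, ∃ r ∈ night4Reps_C4xC2_ns, r = p ∨ cc_C4xC2_ns * r = p := by decide

/-- The count on the representatives (KERNEL). -/
theorem redDim_faceCorners_C4xC2_ns_reps : ∀ Φ ∈ cmTypes cc_C4xC2_ns,
    ∀ p ∈ night4Reps_C4xC2_ns, ∀ p' ∈ night4Reps_C4xC2_ns, p' ∉ place cc_C4xC2_ns p →
      redDim (faceCorners cc_C4xC2_ns Φ p p') = 6 ∨ redDim (faceCorners cc_C4xC2_ns Φ p p') = 7 := by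
  decide +kernel

/-- **Every census face of `(C4 × C2, c = (0, 1))` has `dim B_red = 6` or `7`** (ROUTE.md §3.3: «(c = 1 or 5) 4 classes —
1+2+4 (dim 7) ×2, 1+1+4 (dim 6), 2+4 (dim 6)»).  KERNEL. -/
theorem redDim_faceCorners_C4xC2_ns (Φ : Finset C4xC2) (p p' : C4xC2) (hΦ : IsCMType cc_C4xC2_ns Φ)
    (hp : p' ∉ place cc_C4xC2_ns p) :
    redDim (faceCorners cc_C4xC2_ns Φ p p') = 6 ∨ redDim (faceCorners cc_C4xC2_ns Φ p p') = 7 :=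
  redDim_faceCorners_of_reps cc_C4xC2_ns_isComplexConj night4Reps_C4xC2_ns night4Reps_C4xC2_ns_cover (fun n => n = 6 ∨ n = 7) Φ
    (redDim_faceCorners_C4xC2_ns_reps Φ (mem_cmTypes.2 hΦ)) p p' hp

/-- The value 6 is attained on `(C4 × C2, c = (0, 1))`. -/
theorem redDim_faceCorners_C4xC2_ns_six : ∃ (Φ : Finset C4xC2) (p p' : C4xC2), IsCMType cc_C4xC2_ns Φ ∧
    p' ∉ place cc_C4xC2_ns p ∧ redDim (faceCorners cc_C4xC2_ns Φ p p') = 6 :=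
  ⟨{Multiplicative.ofAdd (0, 1), Multiplicative.ofAdd (1, 1), Multiplicative.ofAdd (2, 1), Multiplicative.ofAdd (3, 1)},
    Multiplicative.ofAdd (0, 0), Multiplicative.ofAdd (2, 0), by decide, by decide, by decide +kernel⟩

/-- The value 7 is attained on `(C4 × C2, c = (0, 1))` (A × S × E — the only sevenfold `B_red` in degree 8). -/
theorem redDim_faceCorners_C4xC2_ns_seven : ∃ (Φ : Finset C4xC2) (p p' : C4xC2), IsCMType cc_C4xC2_ns Φ ∧
    p' ∉ place cc_C4xC2_ns p ∧ redDim (faceCorners cc_C4xC2_ns Φ p p') = 7 :=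
  ⟨{Multiplicative.ofAdd (0, 1), Multiplicative.ofAdd (1, 1), Multiplicative.ofAdd (2, 1), Multiplicative.ofAdd (3, 1)},
    Multiplicative.ofAdd (0, 0), Multiplicative.ofAdd (1, 0), by decide, by decide, by decide +kernel⟩

/-- The corners of `(C4 × C2, c = (0, 1))`: primitive (`4`), lifts from a quartic CM subfield (`2`) and lifts from an
imaginary quadratic subfield (`1`) all occur.  KERNEL. -/
theorem simpleDim_C4xC2_ns : ∀ Φ : Finset C4xC2, IsCMType cc_C4xC2_ns Φ →
    simpleDim Φ = 1 ∨ simpleDim Φ = 2 ∨ simpleDim Φ = 4 := by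
  decide +kernel

/-! ## `C4 × C2`, `c = (2, 1)` (not a square) — `dim B_red ∈ {6, 7}` -/

/-- Representatives of the four places of `(C4 × C2, cc_C4xC2_ns')`. -/
def night4Reps_C4xC2_ns' : List C4xC2 :=
  [Multiplicative.ofAdd (0, 0), Multiplicative.ofAdd (0, 1), Multiplicative.ofAdd (1, 0), Multiplicative.ofAdd (1, 1)]

/-- `night4Reps_C4xC2_ns'` meets every place. -/
theorem night4Reps_C4xC2_ns'_cover : ∀ p : C4xC2, ∃ r ∈ night4Reps_C4xC2_ns', r = p ∨ cc_C4xC2_ns' * r = p := by decide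

/-- The count on the representatives (KERNEL). -/
theorem redDim_faceCorners_C4xC2_ns'_reps : ∀ Φ ∈ cmTypes cc_C4xC2_ns',
    ∀ p ∈ night4Reps_C4xC2_ns', ∀ p' ∈ night4Reps_C4xC2_ns', p' ∉ place cc_C4xC2_ns' p →
      redDim (faceCorners cc_C4xC2_ns' Φ p p') = 6 ∨ redDim (faceCorners cc_C4xC2_ns' Φ p p') = 7 := by
  decide +kernel

/-- **Every census face of `(C4 × C2, c = (2, 1))` has `dim B_red = 6` or `7`** (the second non-square involution; the
route's «c = 1 or 5»).  KERNEL. -/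
theorem redDim_faceCorners_C4xC2_ns' (Φ : Finset C4xC2) (p p' : C4xC2) (hΦ : IsCMType cc_C4xC2_ns' Φ)
    (hp : p' ∉ place cc_C4xC2_ns' p) :
    redDim (faceCorners cc_C4xC2_ns' Φ p p') = 6 ∨ redDim (faceCorners cc_C4xC2_ns' Φ p p') = 7 :=
  redDim_faceCorners_of_reps cc_C4xC2_ns'_isComplexConj night4Reps_C4xC2_ns' night4Reps_C4xC2_ns'_cover (fun n => n = 6 ∨ n = 7) Φ
    (redDim_faceCorners_C4xC2_ns'_reps Φ (mem_cmTypes.2 hΦ)) p p' hp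

/-- The value 6 is attained on `(C4 × C2, c = (2, 1))`. -/
theorem redDim_faceCorners_C4xC2_ns'_six : ∃ (Φ : Finset C4xC2) (p p' : C4xC2), IsCMType cc_C4xC2_ns' Φ ∧
    p' ∉ place cc_C4xC2_ns' p ∧ redDim (faceCorners cc_C4xC2_ns' Φ p p') = 6 :=
  ⟨{Multiplicative.ofAdd (2, 0), Multiplicative.ofAdd (2, 1), Multiplicative.ofAdd (3, 0), Multiplicative.ofAdd (3, 1)},
    Multiplicative.ofAdd (0, 0), Multiplicative.ofAdd (0, 1), by decide, by decide, by decide +kernel⟩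

/-- The value 7 is attained on `(C4 × C2, c = (2, 1))`. -/
theorem redDim_faceCorners_C4xC2_ns'_seven : ∃ (Φ : Finset C4xC2) (p p' : C4xC2), IsCMType cc_C4xC2_ns' Φ ∧
    p' ∉ place cc_C4xC2_ns' p ∧ redDim (faceCorners cc_C4xC2_ns' Φ p p') = 7 :=
  ⟨{Multiplicative.ofAdd (2, 0), Multiplicative.ofAdd (2, 1), Multiplicative.ofAdd (3, 0), Multiplicative.ofAdd (3, 1)},
    Multiplicative.ofAdd (0, 0), Multiplicative.ofAdd (1, 0), by decide, by decide, by decide +kernel⟩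

/-- The corners of `(C4 × C2, c = (2, 1))`: all three stabiliser orders occur.  KERNEL. -/
theorem simpleDim_C4xC2_ns' : ∀ Φ : Finset C4xC2, IsCMType cc_C4xC2_ns' Φ →
    simpleDim Φ = 1 ∨ simpleDim Φ = 2 ∨ simpleDim Φ = 4 := by
  decide +kernel

/-! ## `C2 × C2 × C2`, `c = (1, 0, 0)` — every face has `dim B_red = 6` -/

/-- Representatives of the four places of `(C2 × C2 × C2, cc_C2xC2xC2)`. -/
def night4Reps_C2xC2xC2 : List C2xC2xC2 :=
  [Multiplicative.ofAdd (0, 0, 0), Multiplicative.ofAdd (0, 0, 1), Multiplicative.ofAdd (0, 1, 0),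
    Multiplicative.ofAdd (0, 1, 1)]

/-- `night4Reps_C2xC2xC2` meets every place. -/
theorem night4Reps_C2xC2xC2_cover : ∀ p : C2xC2xC2, ∃ r ∈ night4Reps_C2xC2xC2, r = p ∨ cc_C2xC2xC2 * r = p := by decide

/-- The count on the representatives (KERNEL). -/
theorem redDim_faceCorners_C2xC2xC2_reps : ∀ Φ ∈ cmTypes cc_C2xC2xC2,
    ∀ p ∈ night4Reps_C2xC2xC2, ∀ p' ∈ night4Reps_C2xC2xC2, p' ∉ place cc_C2xC2xC2 p →
      redDim (faceCorners cc_C2xC2xC2 Φ p p') = 6 := by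
  decide +kernel

/-- **Every census face of `(C2 × C2 × C2, c = (1, 0, 0))` has `dim B_red = 6`** (ROUTE.md §3.3: «C2³ …: 6 classes, all
1+1+4 (A × E × E′, E, E′ CM by two DIFFERENT imaginary quadratic subfields)»).  KERNEL. -/
theorem redDim_faceCorners_C2xC2xC2 (Φ : Finset C2xC2xC2) (p p' : C2xC2xC2) (hΦ : IsCMType cc_C2xC2xC2 Φ)
    (hp : p' ∉ place cc_C2xC2xC2 p) : redDim (faceCorners cc_C2xC2xC2 Φ p p') = 6 :=
  redDim_faceCorners_of_reps cc_C2xC2xC2_isComplexConj night4Reps_C2xC2xC2 night4Reps_C2xC2xC2_cover (· = 6) Φ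
    (redDim_faceCorners_C2xC2xC2_reps Φ (mem_cmTypes.2 hΦ)) p p' hp

/-- The value 6 is attained on `C2 × C2 × C2` (a witness face). -/
theorem redDim_faceCorners_C2xC2xC2_six : ∃ (Φ : Finset C2xC2xC2) (p p' : C2xC2xC2), IsCMType cc_C2xC2xC2 Φ ∧
    p' ∉ place cc_C2xC2xC2 p ∧ redDim (faceCorners cc_C2xC2xC2 Φ p p') = 6 :=
  ⟨{Multiplicative.ofAdd (1, 0, 0), Multiplicative.ofAdd (1, 0, 1), Multiplicative.ofAdd (1, 1, 0),
      Multiplicative.ofAdd (1, 1, 1)},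
    Multiplicative.ofAdd (0, 0, 0), Multiplicative.ofAdd (0, 0, 1), by decide, by decide, by decide +kernel⟩

/-- The corners of `(C2 × C2 × C2, c = (1, 0, 0))`: every CM type is primitive (`4`) or a lift from an imaginary quadratic
subfield (`1`); no type is a lift from a quartic subfield.  KERNEL. -/
theorem simpleDim_C2xC2xC2 : ∀ Φ : Finset C2xC2xC2, IsCMType cc_C2xC2xC2 Φ →
    simpleDim Φ = 1 ∨ simpleDim Φ = 4 := by
  decide +kernel

/-! ## The same on the roster's face of the product datum -/

/-- On the product datum of the census face `(Φ; p, p′)` of `(C4 × C2, c = (2, 0))`, `TypeDatum.redDim diagFour ∈ {6, 8}`. -/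
theorem Route.redDim_prodDatum_faceCorners_C4xC2_sq (Φ : Finset C4xC2) (p p' : C4xC2) (hΦ : IsCMType cc_C4xC2_sq Φ)
    (hp : p' ∉ place cc_C4xC2_sq p) :
    (Route.TypeDatum.prodDatum cc_C4xC2_sq_isComplexConj (faceCorners cc_C4xC2_sq Φ p p')
      (isCMType_faceCorners cc_C4xC2_sq_isComplexConj hΦ p p')).redDim Route.diagFour = 6 ∨
    (Route.TypeDatum.prodDatum cc_C4xC2_sq_isComplexConj (faceCorners cc_C4xC2_sq Φ p p')
      (isCMType_faceCorners cc_C4xC2_sq_isComplexConj hΦ p p')).redDim Route.diagFour = 8 := by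
  rw [Route.TypeDatum.redDim_prodDatum]
  exact redDim_faceCorners_C4xC2_sq Φ p p' hΦ hp

/-- On the product datum of the census face `(Φ; p, p′)` of `(C4 × C2, c = (0, 1))`, `TypeDatum.redDim diagFour ∈ {6, 7}`. -/
theorem Route.redDim_prodDatum_faceCorners_C4xC2_ns (Φ : Finset C4xC2) (p p' : C4xC2) (hΦ : IsCMType cc_C4xC2_ns Φ)
    (hp : p' ∉ place cc_C4xC2_ns p) :
    (Route.TypeDatum.prodDatum cc_C4xC2_ns_isComplexConj (faceCorners cc_C4xC2_ns Φ p p')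
      (isCMType_faceCorners cc_C4xC2_ns_isComplexConj hΦ p p')).redDim Route.diagFour = 6 ∨
    (Route.TypeDatum.prodDatum cc_C4xC2_ns_isComplexConj (faceCorners cc_C4xC2_ns Φ p p')
      (isCMType_faceCorners cc_C4xC2_ns_isComplexConj hΦ p p')).redDim Route.diagFour = 7 := by
  rw [Route.TypeDatum.redDim_prodDatum]
  exact redDim_faceCorners_C4xC2_ns Φ p p' hΦ hp

/-- On the product datum of the census face `(Φ; p, p′)` of `(C4 × C2, c = (2, 1))`, `TypeDatum.redDim diagFour ∈ {6, 7}`. -/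
theorem Route.redDim_prodDatum_faceCorners_C4xC2_ns' (Φ : Finset C4xC2) (p p' : C4xC2) (hΦ : IsCMType cc_C4xC2_ns' Φ)
    (hp : p' ∉ place cc_C4xC2_ns' p) :
    (Route.TypeDatum.prodDatum cc_C4xC2_ns'_isComplexConj (faceCorners cc_C4xC2_ns' Φ p p')
      (isCMType_faceCorners cc_C4xC2_ns'_isComplexConj hΦ p p')).redDim Route.diagFour = 6 ∨
    (Route.TypeDatum.prodDatum cc_C4xC2_ns'_isComplexConj (faceCorners cc_C4xC2_ns' Φ p p')
      (isCMType_faceCorners cc_C4xC2_ns'_isComplexConj hΦ p p')).redDim Route.diagFour = 7 := by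
  rw [Route.TypeDatum.redDim_prodDatum]
  exact redDim_faceCorners_C4xC2_ns' Φ p p' hΦ hp

/-- On the product datum of the census face `(Φ; p, p′)` of `C2 × C2 × C2`, `TypeDatum.redDim diagFour = 6`. -/
theorem Route.redDim_prodDatum_faceCorners_C2xC2xC2 (Φ : Finset C2xC2xC2) (p p' : C2xC2xC2)
    (hΦ : IsCMType cc_C2xC2xC2 Φ) (hp : p' ∉ place cc_C2xC2xC2 p) :
    (Route.TypeDatum.prodDatum cc_C2xC2xC2_isComplexConj (faceCorners cc_C2xC2xC2 Φ p p')
      (isCMType_faceCorners cc_C2xC2xC2_isComplexConj hΦ p p')).redDim Route.diagFour = 6 := by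
  rw [Route.TypeDatum.redDim_prodDatum]
  exact redDim_faceCorners_C2xC2xC2 Φ p p' hΦ hp

end HodgeRepro
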